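import Mathlib
import Summits.AnomalousDissipation.AnomalousDissipation.Theses.DyadicWallCascade
import Summits.AnomalousDissipation.AnomalousDissipation.Theorems.HalfSpaceHierarchy.Negative.Reversible

/-!
# No one-signed through-flow in a half-space hierarchy
# (negative lemma for the crux `DyadicWallCascade.HalfSpaceHierarchy`, stmt-AnomalousDissipation-18627)

Refuter file, Negative lane (D-0016), route `DyadicWallCascade` of `Summits/AnomalousDissipation`;
cdisprove seat `refuter-cdisprove-stmt-AnomalousDissipation-18627-0`.

`not_oneSignedFluxHalfSpaceHierarchy`: the crux body (verbatim) together with "`V₃ ≥ 0` on the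
flux square `[0,1]² × {1}`" is FALSE: zero mass flux and a sign make
`|F| ≤ ∫ V₃ · sup |‖V‖²/2 + Q| ≤ (C²/2 + C) ∫ V₃ = 0`.  (The case `V₃ ≤ 0` follows by the symmetry
`(V, Q) ↦ (-V, Q)` of every clause, which flips `F`.)  Reading: census T1 (ii) as a theorem — a
witness has up- AND down-going fluid through the unit square of every horizontal plane, so the flow
has no lattice-periodic transverse section and inflow/outflow through-flow constructions
(Alber 1992 doi:10.1007/bf01444632; Buffoni–Wahlén 2019 doi:10.2140/apde.2019.12.1225) have no
inflow face to integrate transport from.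
-/

open scoped BigOperators Topology InnerProductSpace
open Filter Set MeasureTheory

-- `Summit.<Summit>.<Problem>` is the tree's mandated summit-side namespace (CONVENTIONS §2); for this
-- single-conjunct summit the two coincide, so the duplicate is deliberate.
set_option linter.dupNamespace false

namespace Summit.AnomalousDissipation.AnomalousDissipation.Theorems

open HalfSpaceHierarchyNegative in
/-- **No one-signed through-flow** (refutes the strengthening "crux ∧ `V₃ ≥ 0` on the flux square
`[0,1]² × {1}`" of `DyadicWallCascade.HalfSpaceHierarchy`, stmt-AnomalousDissipation-18627; by the
symmetry `V ↦ -V` of steady Euler the case `V₃ ≤ 0` is the same).  With zero mass flux a one-signed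
continuous `V₃` makes `|F| ≤ ∫ V₃ · sup|B| = 0`.  Reading (census T1 (ii), now a theorem): every
witness has BOTH up- and down-going fluid through the unit square of every horizontal plane, so no
lattice-periodic transverse section of the flow exists and the inflow/outflow through-flow
technology (Alber 1992, Buffoni–Wahlén 2019, which solves transport from an inflow face) has no
face to start from.  Only the bounds, the two flux clauses and continuity on the plane are used.
[folklore] -/
theorem not_oneSignedFluxHalfSpaceHierarchy :
    ¬ (∃ (V : EuclideanSpace ℝ (Fin 3) → EuclideanSpace ℝ (Fin 3)) (Q : EuclideanSpace ℝ (Fin 3) → ℝ) (C F : ℝ),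
        (let H : Set (EuclideanSpace ℝ (Fin 3)) := {X | 0 < X 2}
         let e : Fin 3 → EuclideanSpace ℝ (Fin 3) := fun i => EuclideanSpace.single i (1 : ℝ)
         let pt : ℝ × ℝ → EuclideanSpace ℝ (Fin 3) := fun q => !₂[q.1, q.2, (1 : ℝ)]
         ContDiffOn ℝ ((⊤ : ℕ∞) : WithTop ℕ∞) V H ∧ ContDiffOn ℝ ((⊤ : ℕ∞) : WithTop ℕ∞) Q H ∧
         (∀ X ∈ H, ‖V X‖ ≤ C ∧ |Q X| ≤ C) ∧ (∀ X ∈ H, ∑ i : Fin 3, (fderiv ℝ V X (e i)) i = 0) ∧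
         (∀ X ∈ H, (fderiv ℝ V X) (V X) + gradient Q X = 0) ∧
         (∀ X ∈ H, V ((2 : ℝ) • X) = V X ∧ Q ((2 : ℝ) • X) = Q X) ∧
         (∀ X : EuclideanSpace ℝ (Fin 3), 1 ≤ X 2 → X 2 ≤ 2 →
            V (X + e 0) = V X ∧ V (X + e 1) = V X ∧ Q (X + e 0) = Q X ∧ Q (X + e 1) = Q X) ∧
         (∫ q in Set.Icc (0 : ℝ) 1 ×ˢ Set.Icc (0 : ℝ) 1, (V (pt q)) 2 = 0) ∧ F ≠ 0 ∧
         (∫ q in Set.Icc (0 : ℝ) 1 ×ˢ Set.Icc (0 : ℝ) 1, (V (pt q)) 2 * (‖V (pt q)‖ ^ 2 / 2 + Q (pt q)) = F)) ∧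
        (∀ q : ℝ × ℝ, q ∈ Set.Icc (0 : ℝ) 1 ×ˢ Set.Icc (0 : ℝ) 1 → 0 ≤ (V !₂[q.1, q.2, (1 : ℝ)]) 2)) := by
  rintro ⟨V, Q, C, F, hbody, hsign⟩
  simp only at hbody
  obtain ⟨hVs, hQs, hbdd, _hdiv, _hEul, _hdil, _hper, hmass, hF, hflux⟩ := hbody
  -- bounds on the plane
  have hptH : ∀ q : ℝ × ℝ, (!₂[q.1, q.2, (1 : ℝ)] : EuclideanSpace ℝ (Fin 3)) ∈
      {X : EuclideanSpace ℝ (Fin 3) | 0 < X 2} := by intro q; simp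
  have hC : 0 ≤ C := le_trans (norm_nonneg _) (hbdd _ (hptH (0, 0))).1
  set M : ℝ := C ^ 2 / 2 + C with hM
  have hB : ∀ q : ℝ × ℝ, |‖V !₂[q.1, q.2, (1 : ℝ)]‖ ^ 2 / 2 + Q !₂[q.1, q.2, (1 : ℝ)]| ≤ M := by
    intro q
    obtain ⟨hv, hq⟩ := hbdd _ (hptH q)
    have h1 : ‖V !₂[q.1, q.2, (1 : ℝ)]‖ ^ 2 ≤ C ^ 2 := by
      exact pow_le_pow_left₀ (norm_nonneg _) hv 2
    have h2 : |‖V !₂[q.1, q.2, (1 : ℝ)]‖ ^ 2 / 2| ≤ C ^ 2 / 2 := by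
      rw [abs_of_nonneg (by positivity)]; linarith
    calc |‖V !₂[q.1, q.2, (1 : ℝ)]‖ ^ 2 / 2 + Q !₂[q.1, q.2, (1 : ℝ)]|
        ≤ |‖V !₂[q.1, q.2, (1 : ℝ)]‖ ^ 2 / 2| + |Q !₂[q.1, q.2, (1 : ℝ)]| := abs_add_le _ _
      _ ≤ C ^ 2 / 2 + C := add_le_add h2 hq
  -- continuity, hence integrability, of the traces on the compact square
  have hVc : Continuous fun q : ℝ × ℝ => V !₂[q.1, q.2, (1 : ℝ)] :=
    hVs.continuousOn.comp_continuous continuous_pt hptH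
  have hQc : Continuous fun q : ℝ × ℝ => Q !₂[q.1, q.2, (1 : ℝ)] :=
    hQs.continuousOn.comp_continuous continuous_pt hptH
  have hV2c : Continuous fun q : ℝ × ℝ => (V !₂[q.1, q.2, (1 : ℝ)]) 2 :=
    (PiLp.continuous_apply 2 (fun _ : Fin 3 => ℝ) (2 : Fin 3)).comp hVc
  have hfc : Continuous fun q : ℝ × ℝ =>
      (V !₂[q.1, q.2, (1 : ℝ)]) 2 * (‖V !₂[q.1, q.2, (1 : ℝ)]‖ ^ 2 / 2 + Q !₂[q.1, q.2, (1 : ℝ)]) :=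
    hV2c.mul ((((hVc.norm).pow 2).div_const 2).add hQc)
  have hK : IsCompact (Set.Icc (0 : ℝ) 1 ×ˢ Set.Icc (0 : ℝ) 1) := isCompact_Icc.prod isCompact_Icc
  have hfi : IntegrableOn (fun q : ℝ × ℝ =>
      (V !₂[q.1, q.2, (1 : ℝ)]) 2 * (‖V !₂[q.1, q.2, (1 : ℝ)]‖ ^ 2 / 2 + Q !₂[q.1, q.2, (1 : ℝ)]))
      (Set.Icc (0 : ℝ) 1 ×ˢ Set.Icc (0 : ℝ) 1) := hfc.continuousOn.integrableOn_compact hK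
  have hgi : IntegrableOn (fun q : ℝ × ℝ => (V !₂[q.1, q.2, (1 : ℝ)]) 2 * M)
      (Set.Icc (0 : ℝ) 1 ×ˢ Set.Icc (0 : ℝ) 1) := (hV2c.mul continuous_const).continuousOn.integrableOn_compact hK
  -- |F| ≤ ∫ V₃ · M = M · 0
  have hle : |F| ≤ ∫ q in Set.Icc (0 : ℝ) 1 ×ˢ Set.Icc (0 : ℝ) 1, (V !₂[q.1, q.2, (1 : ℝ)]) 2 * M := by
    rw [← hflux]
    refine le_trans (abs_integral_le_integral_abs (μ := volume.restrict _)) ?_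
    refine setIntegral_mono_on hfi.abs hgi (measurableSet_Icc.prod measurableSet_Icc) fun q hq => ?_
    rw [abs_mul, abs_of_nonneg (hsign q hq)]
    exact mul_le_mul_of_nonneg_left (hB q) (hsign q hq)
  rw [integral_mul_const, hmass, zero_mul] at hle
  exact hF (abs_nonpos_iff.mp hle)

end Summit.AnomalousDissipation.AnomalousDissipation.Theorems
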